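import Summits.Ventures.PercRepro.RankLevelSetUpFiveTargets

/-! # RankLevelSetUpFiveLine — THE LINE OF A TARGET PAIR IS UNIQUE FOR `n ≥ 13` (night-1 g41; dossier §53.6; on
`RankLevelSetUpFiveTargets`)

In the charging of §53 a type-B preimage of a pair `(Z, t)` leaves `n − 9` of the `n − 8` points of
`X := E ∖ (Z ∪ {b, t})` on its line. Two such lines through `X` share `≥ n − 10 ≥ 3` points of `X` as soon as
`n ≥ 13`, and three points of a line without a parallel triple already span it: so the two lines coincide
(**`closure_eq_of_large_subsets`**: two rank-`≤ 2` subsets `A, B` of a set `X` with `#A, #B ≥ #X − 1` and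
`#X ≥ 5` have the same closure). With `n − 9 ≥ 4` points on it, the line is moreover recovered from `X` as the
closure of `X` minus its unique point off the line (**`sdiff_singleton_subset_closure_of_large`**). Every declaration
has a docstring; imports: the cell's own modules and Mathlib only. Axioms: standard. -/

namespace PercRepro

open Set Matroid

variable {α : Type}

/-- **Two large rank-`≤ 2` subsets of a small set span the same line**: `A, B ⊆ X ⊆ E` of nonloops without a
parallel triple, `rk A ≤ 2`, `rk B ≤ 2`, `#X ≤ #A + 1`, `#X ≤ #B + 1`, `5 ≤ #X`; then `cl A = cl B`. -/
lemma closure_eq_of_large_subsets {N : Matroid α} [N.Finite] {X A B : Set α} (hXE : X ⊆ N.E)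
    (hnl : ∀ e ∈ N.E, N.IsNonloop e)
    (hnt : ∀ p ∈ N.E, ∀ q ∈ N.E, ∀ r ∈ N.E, p ≠ q → p ≠ r → q ≠ r → q ∈ N.closure {p} → r ∉ N.closure {p})
    (hA : A ⊆ X) (hB : B ⊆ X) (hA2 : N.eRk A ≤ 2) (hB2 : N.eRk B ≤ 2) (hAX : X.ncard ≤ A.ncard + 1)
    (hBX : X.ncard ≤ B.ncard + 1) (hX5 : 5 ≤ X.ncard) : N.closure A = N.closure B := by
  have hXfin : X.Finite := N.ground_finite.subset hXE
  have hAfin : A.Finite := hXfin.subset hA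
  have hBfin : B.Finite := hXfin.subset hB
  -- `#(A ∩ B) ≥ #X − 2 ≥ 3`
  have hAB : 2 < (A ∩ B).ncard := by
    have h1 := Set.ncard_union_add_ncard_inter A B hAfin hBfin
    have h2 : (A ∪ B).ncard ≤ X.ncard := Set.ncard_le_ncard (Set.union_subset hA hB) hXfin
    omega
  have hABE : A ∩ B ⊆ N.E := Set.inter_subset_left.trans (hA.trans hXE)
  have h2 : 2 ≤ N.eRk (A ∩ B) :=
    two_le_eRk_of_two_lt_ncard hABE (fun e he => hnl e (hABE he))
      (fun p hp q hq r hr => hnt p (hABE hp) q (hABE hq) r (hABE hr)) hAB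
  have hfinAB : N.IsRkFinite (A ∩ B) := N.isRkFinite_of_finite (hXfin.subset (Set.inter_subset_left.trans hA))
  have hclA : N.closure (A ∩ B) = N.closure A :=
    hfinAB.closure_eq_closure_of_subset_of_eRk_ge_eRk Set.inter_subset_left (hA2.trans h2)
  have hclB : N.closure (A ∩ B) = N.closure B :=
    hfinAB.closure_eq_closure_of_subset_of_eRk_ge_eRk Set.inter_subset_right (hB2.trans h2)
  rw [← hclA, ← hclB]

/-- **A rank-`≤ 2` subset with all but one point of `X` determines the point off its line**: if `A ⊆ X` has rank
`≤ 2`, `#A + 1 = #X`, `4 ≤ #A`, and `X ⊄ cl A`, then the unique point `x ∈ X ∖ A` is off `cl A`, and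
`X ∖ {x} = A`. -/
lemma sdiff_singleton_subset_closure_of_large {N : Matroid α} [N.Finite] {X A : Set α} (hXE : X ⊆ N.E)
    (hA : A ⊆ X) (hAX : A.ncard + 1 = X.ncard) (hXA : ¬ X ⊆ N.closure A) :
    ∃ x ∈ X, x ∉ N.closure A ∧ X \ {x} = A := by
  have hXfin : X.Finite := N.ground_finite.subset hXE
  obtain ⟨x, hxX, hxA⟩ := Set.not_subset.mp hXA
  have hxA' : x ∉ A := fun h => hxA (N.subset_closure A (hA.trans hXE) h)
  refine ⟨x, hxX, hxA, ?_⟩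
  -- `A ⊆ X ∖ {x}` and the cardinalities agree
  have hsub : A ⊆ X \ {x} := fun a ha => ⟨hA ha, fun h => hxA' (by rw [Set.mem_singleton_iff] at h; rw [← h]; exact ha)⟩
  have hcard : (X \ {x}).ncard = A.ncard := by
    rw [Set.ncard_sdiff_singleton_of_mem hxX]; omega
  exact (Set.eq_of_subset_of_ncard_le hsub hcard.le (hXfin.subset Set.sdiff_subset)).symm

end PercRepro
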